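import Summits.BirchSwinnertonDyer.BirchSwinnertonDyer.Theorems.GoldfeldAllTwistsTwoConverseTwinGenusRankOneRat
import Summits.BirchSwinnertonDyer.BirchSwinnertonDyer.Theorems.GoldfeldAllTwistsTwoConverseTwinGenusDescentNegTwo
import HarnessLib

set_option linter.dupNamespace false
set_option autoImplicit false

/-!
# LINE B49, genus assembly, family F2 (`d_K = −8q`), step W-A2′ part I: over an imaginary quadratic `K` with
# `d_K = −8q`, every `K`-point of the `3136⁻`-curve `49a1^{(−2)}` is, up to torsion and one factor `2`, an ODD-index
# multiple of the fixed point `(4, 8)` — from CLTZ 2015 Thm 1.2 and seat c301's odd-index theorem over `ℚ`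

Cell `bsd-goldfeld`, seat `bsd-goldfeld-s1p-c3` (prover, gen 8); memo `HOME/B49-GENUS.md` §1 (family F2), the F2
analogue of `…TwinGenusRankOneRat` (family F1). Support for item `stmt-BirchSwinnertonDyer-19140` (crux twin″; joint
with 20044 K12₂″). Theorems only. HONEST FRAMING: BSD is not proved by any of this; the one printed input is
Coates–Li–Tian–Zhai 2015 Thm 1.2 (`CoatesLiTianZhai2015.thm12_fullBSD_twist`, binder `h12`).

CONTENTS.
* §1 the model identity `(cm7^{(−2)})^{(−8q)} = ⟨1/4, 0, 0, 0⟩ • cm7^{(q)}` (both are `ℚ`-models of `49a1^{(q)}`, as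
  `(−2)·(−8q) = 4²·q`) and `isOfFinAddOrder_point_twist3136`: every `ℚ`-point of `(cm7^{(−2)})^{(−8q)}` is torsion
  (CLTZ Thm 1.2 via gen 7's `isOfFinAddOrder_point_cm7_quadraticTwist_prime`).
* §2 `exists_odd_two_mul_zsmul_sub_incl_fourEight` — THE `K/ℚ` STEP of (RO′): for `K` imaginary quadratic with
  `d_K = −8q` (`q ≡ 1 (mod 4)` prime, `(q/7) = −1`) and every `P ∈ V(K)`, `V = (cm7^{(−2)})^{(1)} (= cm7^{(−2)})`: there
  are an ODD `n` and `a ∈ ℤ` with `(2n) • P − a • (4, 8)` torsion. Proof as in F1: `2P = (P + σP) + (P − σP)` with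
  `σ` the conjugation of `K/ℚ`; `P + σP ∈ V(ℚ)` where seat c301's
  `exists_odd_zsmul_sub_zsmul_fourEight_cm7_quadraticTwist_neg_two` applies; `P − σP` comes from the twist
  `V^{(d_K)}(ℚ)`, all torsion (§1).

References: J. Coates, Y. Li, Y. Tian, S. Zhai, PLMS 110 (2015) Thm 1.2 [CoatesLiTianZhai2015]; J. H. Silverman, AEC
(2009) X.2 Prop 2.4, Ex. 10.16 [SilvermanAEC2009]; J. H. Silverman, J. T. Tate (2015) §3.5 [SilvermanTate2015].
-/

noncomputable section

open scoped Classical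

open WeierstrassCurve Literature.NumberTheory.EllipticCurves
  Literature.NumberTheory.EllipticCurves.ModularForms

namespace Summit.BirchSwinnertonDyer.BirchSwinnertonDyer.Theorems.GoldfeldGoodTwists

-- One decidability world for all point groups (ℚ, K, the genus field, K[1]): the classical one, as in
-- `…TwinGenusRankOneRat` (whose lemmas are consumed here verbatim).
attribute [local instance 2000] Classical.propDecidable

/-! ## §1 Every `ℚ`-point of `(49a1^{(−2)})^{(−8q)}` is torsion (CLTZ Thm 1.2) -/

section RankZeroNegTwo

/-- The model identity `(cm7^{(−2)})^{(−8q)} = ⟨1/4, 0, 0, 0⟩ • cm7^{(q)}` (both are `ℚ`-models of `49a1^{(q)}`: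
`(−2)·(−8q) = 4²·q`). [cite: SilvermanAEC2009, X.2 Prop. 2.4] -/
theorem quadraticTwist_neg_two_quadraticTwist_eq_smul (q : ℚ) :
    (cm7.quadraticTwist (-2)).quadraticTwist (-(8 * q)) =
      (⟨Units.mk0 (4 : ℚ)⁻¹ (by norm_num), 0, 0, 0⟩ : VariableChange ℚ) • cm7.quadraticTwist q := by
  ext <;> simp [quadraticTwist, b₂, b₄, b₆, variableChange_a₁, variableChange_a₂, variableChange_a₃,
    variableChange_a₄, variableChange_a₆] <;> ring

/-- **Every `ℚ`-point of `(49a1^{(−2)})^{(−8q)}` is torsion** for a prime `q ≡ 1 (mod 4)` with `(q/7) = −1` (same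
curve as `49a1^{(q)}`, of rank `0` by Coates–Li–Tian–Zhai 2015 Thm 1.2). [cite: CoatesLiTianZhai2015, Thm. 1.2 (p. 359)] -/
theorem isOfFinAddOrder_point_twist3136 (h12 : CoatesLiTianZhai2015.thm12_fullBSD_twist)
    {q : ℕ} (hq : q.Prime) (hq4 : q % 4 = 1) (hq7 : jacobiSym q 7 = -1)
    (P : ((cm7.quadraticTwist (-2)).quadraticTwist (-(8 * (q : ℚ)))).toAffine.Point) : IsOfFinAddOrder P := by
  let e : ((cm7.quadraticTwist (-2)).quadraticTwist (-(8 * (q : ℚ)))).toAffine.Point ≃+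
      (cm7.quadraticTwist (q : ℚ)).toAffine.Point :=
    (Affine.Point.congrEquiv (quadraticTwist_neg_two_quadraticTwist_eq_smul (q : ℚ))).trans
      (VariableChange.pointEquiv (cm7.quadraticTwist (q : ℚ)) _).symm
  have h := isOfFinAddOrder_point_cm7_quadraticTwist_prime h12 hq hq4 hq7 (e P)
  have := e.symm.toAddMonoidHom.isOfFinAddOrder h
  simpa using this

end RankZeroNegTwo

/-! ## §2 The `K/ℚ` step: `K`-points of `49a1^{(−2)}` against `(4, 8)` -/

section RatStepNegTwo

/-- The completed-square copy of `cm7^{(−2)}` is `cm7^{(−2)}` itself (`a₁ = a₃ = 0` already).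
[cite: SilvermanAEC2009, III.1] -/
theorem quadraticTwist_neg_two_quadraticTwist_one :
    (cm7.quadraticTwist (-2)).quadraticTwist 1 = cm7.quadraticTwist (-2) := by
  ext <;> simp [quadraticTwist, b₂, b₄, b₆]

/-- `(4, 8)` lies on the completed-square copy of `cm7^{(−2)}`. [folklore] -/
theorem nonsingular_twist3136_one_four_eight :
    ((cm7.quadraticTwist (-2)).quadraticTwist 1).toAffine.Nonsingular 4 8 := by
  rw [quadraticTwist_neg_two_quadraticTwist_one]
  exact nonsingular_cm7_quadraticTwist_neg_two_four_eight

variable {K : Type} [Field K] [NumberField K]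

/-- **The `K/ℚ` step of (RO′) (family F2).** Let `K` be imaginary quadratic with `d_K = −8q`, `q ≡ 1 (mod 4)` prime
with `(q/7) = −1`, and `V = (cm7^{(−2)})^{(1)}` (`= cm7^{(−2)}`, a model of the `3136⁻`-curve `49a1^{(−2)}`). Then for
EVERY `P ∈ V(K)` there are an ODD `n` and `a ∈ ℤ` with `(2n) • P − a • (4, 8)` torsion. With `σ` the conjugation of
`K/ℚ`: `2P = (P + σP) + (P − σP)`; `P + σP ∈ V(ℚ)`, where seat c301's odd-index theorem gives
`n • (P + σP) ≡ a • (4,8)` mod torsion (`n` odd); `P − σP = τ(R)` for a point `R` of the twist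
`V^{(d_K)} = (49a1^{(−2)})^{(−8q)} ≅ 49a1^{(q)}` over `ℚ`, which is torsion by CLTZ 2015 Thm 1.2 (§1).
[cite: CoatesLiTianZhai2015, Thm. 1.2 (p. 359)] [cite: SilvermanAEC2009, Exercise 10.16]
[cite: SilvermanTate2015, §3.5] -/
theorem exists_odd_two_mul_zsmul_sub_incl_fourEight (h12 : CoatesLiTianZhai2015.thm12_fullBSD_twist)
    (hK : IsImaginaryQuadratic K) {q : ℕ} (hq : q.Prime) (hq4 : q % 4 = 1) (hq7 : jacobiSym q 7 = -1)
    (hdK : NumberField.discr K = -(8 * (q : ℤ)))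
    (P : (((cm7.quadraticTwist (-2)).quadraticTwist 1).baseChange K).toAffine.Point) :
    ∃ n a : ℤ, Odd n ∧ IsOfFinAddOrder ((2 * n) • P -
      a • QuadraticDescent.incl K ((cm7.quadraticTwist (-2)).quadraticTwist 1)
        (Affine.Point.some 4 8 nonsingular_twist3136_one_four_eight)) := by
  obtain ⟨δ, hδ, hδK, -⟩ := exists_sq_eq_discr_and_span hK
  have hθ : δ ∉ Set.range (algebraMap ℚ K) := by rintro ⟨a, ha⟩; exact hδK a ha
  have hσσ : ∀ z, Literature.NumberTheory.QuadraticFields.Quadratic.conj hK.1 hθ hδ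
      (Literature.NumberTheory.QuadraticFields.Quadratic.conj hK.1 hθ hδ z) = z :=
    Literature.NumberTheory.QuadraticFields.Quadratic.conj_conj hK.1 hθ hδ
  -- the `σ`-fixed part comes from `V₁(ℚ)`
  obtain ⟨Q, hQ⟩ : ∃ Q : ((cm7.quadraticTwist (-2)).quadraticTwist 1).toAffine.Point,
      QuadraticDescent.incl K ((cm7.quadraticTwist (-2)).quadraticTwist 1) Q =
      P + QuadraticDescent.conjMap ((cm7.quadraticTwist (-2)).quadraticTwist 1)
        (Literature.NumberTheory.QuadraticFields.Quadratic.conj hK.1 hθ hδ) P :=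
    exists_incl_eq_of_conjMap_eq ((cm7.quadraticTwist (-2)).quadraticTwist 1) hK.1 hθ hδ (by
      rw [map_add, QuadraticDescent.conjMap_conjMap ((cm7.quadraticTwist (-2)).quadraticTwist 1) hσσ, add_comm])
  -- the `σ`-anti-fixed part comes from the twist by `d_K`, all of whose `ℚ`-points are torsion
  obtain ⟨R, hR⟩ : ∃ R : ((cm7.quadraticTwist (-2)).quadraticTwist (NumberField.discr K : ℚ)).toAffine.Point,
      QuadraticDescent.twistMap (cm7.quadraticTwist (-2)) hθ hδ R =
        P - QuadraticDescent.conjMap ((cm7.quadraticTwist (-2)).quadraticTwist 1)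
          (Literature.NumberTheory.QuadraticFields.Quadratic.conj hK.1 hθ hδ) P :=
    exists_twistMap_eq_of_conjMap_eq_neg (cm7.quadraticTwist (-2)) hK.1 hθ hδ (by
      rw [map_sub, QuadraticDescent.conjMap_conjMap ((cm7.quadraticTwist (-2)).quadraticTwist 1) hσσ, neg_sub])
  have hRt : IsOfFinAddOrder R := by
    have hc : (NumberField.discr K : ℚ) = -(8 * (q : ℚ)) := by rw [hdK]; push_cast; ring
    have e := Affine.Point.congrEquiv (congrArg (cm7.quadraticTwist (-2)).quadraticTwist hc)
    have h := isOfFinAddOrder_point_twist3136 h12 hq hq4 hq7 (e R)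
    simpa using e.symm.toAddMonoidHom.isOfFinAddOrder h
  -- seat c301's odd index on `V(ℚ)`, transported to the completed-square copy `V₁ = V`
  let e₀ : (cm7.quadraticTwist (-2)).toAffine.Point ≃+ ((cm7.quadraticTwist (-2)).quadraticTwist 1).toAffine.Point :=
    Affine.Point.congrEquiv quadraticTwist_neg_two_quadraticTwist_one.symm
  obtain ⟨n, a, hn, hQa⟩ := exists_odd_zsmul_sub_zsmul_fourEight_cm7_quadraticTwist_neg_two (e₀.symm Q)
  have hQa' : IsOfFinAddOrder (n • e₀.symm Q -
      a • Affine.Point.some 4 8 nonsingular_cm7_quadraticTwist_neg_two_four_eight) := by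
    convert hQa
  have hQ1 : IsOfFinAddOrder (n • Q - a • Affine.Point.some 4 8 nonsingular_twist3136_one_four_eight) := by
    have h := e₀.toAddMonoidHom.isOfFinAddOrder hQa'
    rw [map_sub, map_zsmul, map_zsmul, AddEquiv.coe_toAddMonoidHom, AddEquiv.apply_symm_apply] at h
    have h01 : e₀ (Affine.Point.some 4 8 nonsingular_cm7_quadraticTwist_neg_two_four_eight) =
        Affine.Point.some 4 8 nonsingular_twist3136_one_four_eight :=
      Affine.Point.congrEquiv_some _ _
    rwa [h01] at h
  refine ⟨n, a, hn, ?_⟩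
  have e2 : (P + QuadraticDescent.conjMap ((cm7.quadraticTwist (-2)).quadraticTwist 1)
        (Literature.NumberTheory.QuadraticFields.Quadratic.conj hK.1 hθ hδ) P) +
      (P - QuadraticDescent.conjMap ((cm7.quadraticTwist (-2)).quadraticTwist 1)
        (Literature.NumberTheory.QuadraticFields.Quadratic.conj hK.1 hθ hδ) P) = (2 : ℤ) • P := by
    abel
  have hdec : (2 * n) • P - a • QuadraticDescent.incl K ((cm7.quadraticTwist (-2)).quadraticTwist 1)
        (Affine.Point.some 4 8 nonsingular_twist3136_one_four_eight) =
      QuadraticDescent.incl K ((cm7.quadraticTwist (-2)).quadraticTwist 1)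
          (n • Q - a • Affine.Point.some 4 8 nonsingular_twist3136_one_four_eight) +
        n • QuadraticDescent.twistMap (cm7.quadraticTwist (-2)) hθ hδ R := by
    rw [mul_comm, ← smul_smul, ← e2, ← hQ, ← hR, smul_add, map_sub, map_zsmul, map_zsmul]
    abel
  rw [hdec]
  exact isOfFinAddOrder_add'
    ((QuadraticDescent.incl K ((cm7.quadraticTwist (-2)).quadraticTwist 1)).isOfFinAddOrder hQ1)
    (isOfFinAddOrder_zsmul n ((QuadraticDescent.twistMap _ hθ hδ).isOfFinAddOrder hRt))

end RatStepNegTwo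

end Summit.BirchSwinnertonDyer.BirchSwinnertonDyer.Theorems.GoldfeldGoodTwists

end
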